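import Summits.CriticalPhenomena.PercolationContinuityZ3.Theorems.PercNearOneGluingNoHeavyLowerTailFKHullPortDeltaNBase
import Summits.CriticalPhenomena.PercolationContinuityZ3.Theorems.PercNearOneGluingNoHeavyLowerTailHullPortTACond
import Literature.Probability.Percolation.TwoClusterConditionalAssociation
import Literature.Probability.Percolation.KozmaNitzanPreFKG
import Summits.CriticalPhenomena.PercolationContinuityZ3.Theorems.PercNearOneGluingNoHeavyLowerTailCILUnionExchange
import HarnessLib

/-!
# FK sub-lane: tools for Lemma `P_v` for `φ_{𝐩,q}` (classes of `C_v`, world = conditional covariance, the CPA step)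

Support file (`--supports stmt-CriticalPhenomena-4575`), FK sub-lane `prim-bschramm-fk-2` (gen 3); builds on p205010 (kernel theorem,
internal audit signed; external expert review pending).  No definitions, no named facts, no sorries; standard axioms.

Ingredients of prim-hp-7's Lemma `P_v` (HP7-MDLX-PROOF §1; bschramm/FK-Q2.md §12.3) for the random-cluster measure
`φ = rcMeasureW u q ∅`, which is the hypothesis `hPv` of `FK.taQ_nonneg_of_Pv` / `FK.deltaN_nonneg_of_Pv`:
* `FK.sum_rcMass_mul_condProb` — reindexing over the classes `E_ω = {C_v = C_v(ω)}`:
  `E[h · φ(B | σ(C_v))] = E[h · 1_B]` for `h` constant on classes;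
* `FK.taC_singleton_indicator_eq` — on `{v ↮ s}` the world covariance `taC u q s y {v} 1_U ω` (world `φ_{u − C̄_v(ω)}`) equals the
  conditional covariance of `{C_s ∈ U}` and `{s ↔ y}` given the class `E_ω` (vdBHK Lemma 2.3 for `φ_{𝐩,q}`,
  `BHK2006_rcMeasureW_real_setCl_inter`);
* `FK.real_clusterEvent_openConn_notConn_mul_le` — the conditional positive association of `C_s` given `{s ↮ y}`
  (vdBHK Thm 1.3 for `φ_{𝐩,q}`, `BHK2006_clusterConditionalPositiveAssociation_rc`) tested against the decreasing world
  probability `φ_{G − C̄_s}(y ↔ v)` (Lemma 2.4 summed, `rc_set_sum_cond_cluster`):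
  `φ(C_s ∈ U, y ↔ v, s ↮ y)·φ(s ↮ y) ≤ φ(y ↔ v, s ↮ y)·φ(C_s ∈ U, s ↮ y)`.
[cite: VandenbergHaggstromKahn2005, Thm. 1.3 (p. 6), §2.1 Lemmas 2.3–2.4 (p. 10)] [cite: Grimmett2006, Thm. (3.8)(b) (p. 39)]
[cite: Gladkov2024, §2]
-/

noncomputable section

namespace Summit.CriticalPhenomena.PercolationContinuityZ3.Theorems.FK

open MeasureTheory Set
open Literature.Probability.LatticeModels Literature.Probability.Percolation
open Literature.Probability.Percolation.DecisionTree (ind ind_of_mem ind_of_not_mem ind_nonneg)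
open Literature.Probability.Percolation.BHK2006 (rcMass rcMass_nonneg sum_rcMass delW setCl barOf rcMass_fkg
  integral_rcMeasureW_eq_sum rcMeasureW_real_eq_sum_rcMass setCl_eq_sdiff_barOf openEdgeCluster_mono ind_inter setCl_mono
  delW_anti barOf_mono sum_rcMass_mono_weights rc_set_sum_cond_cluster setIntegral_rcMeasureW_eq_sum)
open Literature.Probability.Percolation.KNPreFKG
open Summit.CriticalPhenomena.PercolationContinuityZ3.Theorems.HullPort (cut avoidEv cut_eq_barOf)
open scoped Classical

variable {V : Type*} [Fintype V]

/-! ### Classes of the cluster of `v` -/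

omit [Fintype V] in
/-- Having the same open edge cluster of `v` is an equivalence: classes of equal elements coincide. [folklore] -/
theorem clusterClass_eq_of_mem {ω ω' : BondConfig V} {v : V}
    (h : ω' ∈ {ζ : BondConfig V | openEdgeCluster ζ v = openEdgeCluster ω v}) :
    {ζ : BondConfig V | openEdgeCluster ζ v = openEdgeCluster ω' v} = {ζ : BondConfig V | openEdgeCluster ζ v = openEdgeCluster ω v} := by
  have h' : openEdgeCluster ω' v = openEdgeCluster ω v := h
  ext ζ; simp only [Set.mem_setOf_eq, h']

/-- **Reindexing over the classes `{C_v = W}`**: for `h` constant on classes,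
`Σ_ω φ{ω} h(ω) φ(B ∩ E_ω)/φ(E_ω) = φ-mass of `h·1_B``, i.e. `E[h · φ(B | σ(C_v))] = E[h 1_B]`. [folklore] -/
theorem sum_rcMass_mul_condProb (w : Sym2 V → unitInterval) {q : ℝ} (hq : 0 < q) (v : V) (B : Set (BondConfig V))
    (h : BondConfig V → ℝ)
    (hh : ∀ ω ω' : BondConfig V, openEdgeCluster ω' v = openEdgeCluster ω v → h ω' = h ω) :
    ∑ ω, rcMass w q ω * (h ω * ((rcMeasureW w q ∅).real (B ∩ {ζ | openEdgeCluster ζ v = openEdgeCluster ω v}) /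
        (rcMeasureW w q ∅).real {ζ | openEdgeCluster ζ v = openEdgeCluster ω v})) =
      ∑ ω, rcMass w q ω * (h ω * ind B ω) := by
  classical
  set E : BondConfig V → Set (BondConfig V) := fun ω => {ζ | openEdgeCluster ζ v = openEdgeCluster ω v} with hE
  have hEsymm : ∀ ω ω', ω' ∈ E ω → ω ∈ E ω' := fun ω ω' h' => by
    simp only [hE, Set.mem_setOf_eq] at h' ⊢; exact h'.symm
  have hEeq : ∀ ω ω', ω' ∈ E ω → E ω' = E ω := fun ω ω' h' => clusterClass_eq_of_mem h'
  -- expand the conditional probabilities as sums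
  have hB : ∀ ω, (rcMeasureW w q ∅).real (B ∩ E ω) = ∑ ω', rcMass w q ω' * (ind B ω' * ind (E ω) ω') := by
    intro ω
    rw [rcMeasureW_real_eq_sum_rcMass w hq]
    refine Finset.sum_congr rfl fun ω' _ => ?_
    rw [ind_inter]
  have hEmass : ∀ ω, (rcMeasureW w q ∅).real (E ω) = ∑ ω', rcMass w q ω' * ind (E ω) ω' := fun ω =>
    rcMeasureW_real_eq_sum_rcMass w hq _
  -- if a class has mass zero, its members have mass zero
  have hzero : ∀ ω, (rcMeasureW w q ∅).real (E ω) = 0 → rcMass w q ω = 0 := by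
    intro ω h0
    have hle : rcMass w q ω * ind (E ω) ω ≤ ∑ ω', rcMass w q ω' * ind (E ω) ω' :=
      Finset.single_le_sum (f := fun ω' => rcMass w q ω' * ind (E ω) ω')
        (fun ω' _ => mul_nonneg (rcMass_nonneg w hq ω') (ind_nonneg _ _)) (Finset.mem_univ ω)
    rw [← hEmass, h0, ind_of_mem (show ω ∈ E ω from rfl), mul_one] at hle
    exact le_antisymm hle (rcMass_nonneg w hq ω)
  -- rewrite the left side as a double sum and swap
  calc ∑ ω, rcMass w q ω * (h ω * ((rcMeasureW w q ∅).real (B ∩ E ω) / (rcMeasureW w q ∅).real (E ω)))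
      = ∑ ω, ∑ ω', rcMass w q ω * h ω / (rcMeasureW w q ∅).real (E ω) * (rcMass w q ω' * (ind B ω' * ind (E ω) ω')) := by
        refine Finset.sum_congr rfl fun ω _ => ?_
        rw [hB ω]
        simp only [div_eq_mul_inv, Finset.sum_mul, Finset.mul_sum]
        refine Finset.sum_congr rfl fun ω' _ => ?_
        ring
    _ = ∑ ω', ∑ ω, rcMass w q ω * h ω / (rcMeasureW w q ∅).real (E ω) * (rcMass w q ω' * (ind B ω' * ind (E ω) ω')) :=
        Finset.sum_comm
    _ = ∑ ω', rcMass w q ω' * (h ω' * ind B ω') := by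
        refine Finset.sum_congr rfl fun ω' _ => ?_
        -- inside: only `ω` with `ω' ∈ E ω`, i.e. `ω ∈ E ω'`, contribute; there `h ω = h ω'`, `E ω = E ω'`
        have hterm : ∀ ω, rcMass w q ω * h ω / (rcMeasureW w q ∅).real (E ω) * (rcMass w q ω' * (ind B ω' * ind (E ω) ω')) =
            rcMass w q ω' * (h ω' * ind B ω') / (rcMeasureW w q ∅).real (E ω') * (rcMass w q ω * ind (E ω') ω) := by
          intro ω
          by_cases hm : ω' ∈ E ω
          · have h1 : h ω = h ω' := (hh ω' ω (hEsymm ω ω' hm)).symm ▸ rfl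
            have h1' : h ω' = h ω := hh ω ω' hm
            rw [ind_of_mem hm, ind_of_mem (hEsymm ω ω' hm), hEeq ω ω' hm, h1']
            ring
          · have hm' : ω ∉ E ω' := fun h' => hm (hEsymm ω' ω h')
            rw [ind_of_not_mem hm, ind_of_not_mem hm']
            ring
        simp only [hterm, ← Finset.mul_sum]
        rw [← hEmass ω']
        by_cases h0 : (rcMeasureW w q ∅).real (E ω') = 0
        · rw [hzero ω' h0]; simp
        · field_simp

/-! ### Indicators of cluster events, positivity of classes -/

omit [Fintype V] in
/-- `1_U(C_s(η)) = 1{η : C_s(η) ∈ U}`. [folklore] -/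
theorem indicator_one_openEdgeCluster (U : Set (Set (Sym2 V))) (s : V) (η : BondConfig V) :
    U.indicator (1 : Set (Sym2 V) → ℝ) (openEdgeCluster η s) = ind {ω : BondConfig V | openEdgeCluster ω s ∈ U} η := by
  by_cases h : openEdgeCluster η s ∈ U
  · rw [Set.indicator_of_mem h, ind_of_mem (show η ∈ {ω : BondConfig V | openEdgeCluster ω s ∈ U} from h)]; rfl
  · rw [Set.indicator_of_notMem h, ind_of_not_mem (show η ∉ {ω : BondConfig V | openEdgeCluster ω s ∈ U} from h)]

/-- A configuration of positive `φ_{u,q}`-mass lies in a class `{C_v = C_v(ω)}` of positive probability. [folklore] -/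
theorem rcMeasureW_real_clusterClass_pos (u : Sym2 V → unitInterval) {q : ℝ} (hq : 0 < q) (v : V) {ω : BondConfig V}
    (hne : rcMass u q ω ≠ 0) :
    0 < (rcMeasureW u q ∅).real {ζ : BondConfig V | openEdgeCluster ζ v = openEdgeCluster ω v} := by
  haveI := isProbabilityMeasure_rcMeasureW u hq (∅ : Set V)
  have hmass : (rcMeasureW u q ∅).real {ω} = rcMass u q ω := by
    rw [rcMeasureW_real_singleton u hq]; rfl
  have hle : (rcMeasureW u q ∅).real {ω} ≤
      (rcMeasureW u q ∅).real {ζ : BondConfig V | openEdgeCluster ζ v = openEdgeCluster ω v} :=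
    measureReal_mono (Set.singleton_subset_iff.2 rfl) (measure_ne_top _ _)
  rw [hmass] at hle
  exact lt_of_lt_of_le (lt_of_le_of_ne (rcMass_nonneg u hq ω) (Ne.symm hne)) hle

/-! ### The world covariance on `{v ↮ s}` is the class-conditional covariance -/

/-- **World covariance = class-conditional covariance (vdBHK Lemma 2.3 for `φ_{𝐩,q}`).**  On `{v ↮ s}`, for `ω` of
positive mass and `W = C_v(ω)`, the `φ_{u − W̄}`-probabilities of the `C_s`-events `A = {C_s ∈ U}`, `Y = {s ↔ y}` and `A ∩ Y`
are the conditional `φ_u`-probabilities given the class `E_ω = {C_v = W}`; hence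
`taC u q s y {v} 1_U ω = φ(A ∩ Y | E_ω) − φ(A | E_ω)·φ(Y | E_ω)`.
[cite: VandenbergHaggstromKahn2005, §2.1 Lemma 2.3 (p. 10)] [cite: Grimmett2006, Thm. (3.8)] -/
theorem taC_singleton_indicator_eq (u : Sym2 V → unitInterval) {q : ℝ} (hq : 0 < q) {s y v : V} (hvs : ¬ v = s)
    (U : Set (Set (Sym2 V))) {ω : BondConfig V} (hωG : ¬ (openGraph ω).Reachable v s) (hne : rcMass u q ω ≠ 0) :
    taC u q s y {v} (U.indicator 1) ω =
      (rcMeasureW u q ∅).real (({η : BondConfig V | openEdgeCluster η s ∈ U} ∩ (openConn s y : Set (BondConfig V))) ∩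
            {ζ : BondConfig V | openEdgeCluster ζ v = openEdgeCluster ω v}) /
          (rcMeasureW u q ∅).real {ζ : BondConfig V | openEdgeCluster ζ v = openEdgeCluster ω v} -
        (rcMeasureW u q ∅).real ({η : BondConfig V | openEdgeCluster η s ∈ U} ∩
              {ζ : BondConfig V | openEdgeCluster ζ v = openEdgeCluster ω v}) /
            (rcMeasureW u q ∅).real {ζ : BondConfig V | openEdgeCluster ζ v = openEdgeCluster ω v} *
          ((rcMeasureW u q ∅).real ((openConn s y : Set (BondConfig V)) ∩
                {ζ : BondConfig V | openEdgeCluster ζ v = openEdgeCluster ω v}) /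
            (rcMeasureW u q ∅).real {ζ : BondConfig V | openEdgeCluster ζ v = openEdgeCluster ω v}) := by
  classical
  haveI := isProbabilityMeasure_rcMeasureW u hq (∅ : Set V)
  have hEp := rcMeasureW_real_clusterClass_pos u hq v hne
  set A : Set (BondConfig V) := {η : BondConfig V | openEdgeCluster η s ∈ U} with hA
  set Y : Set (BondConfig V) := openConn s y with hY
  set Eω : Set (BondConfig V) := {ζ : BondConfig V | openEdgeCluster ζ v = openEdgeCluster ω v} with hE
  have hgA : ∀ η : BondConfig V, U.indicator (1 : Set (Sym2 V) → ℝ) (openEdgeCluster η s) = ind A η :=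
    indicator_one_openEdgeCluster U s
  set W := openEdgeCluster ω v with hW
  have hsetCl : setCl ω {v} = W := by simp [setCl, hW]
  have hcut : cut {v} ω = barOf {v} W := by rw [cut_eq_barOf, hsetCl]
  -- the event `{C_v = W}` in the library's form
  have hEv : {ζ : BondConfig V | (⋃ s' ∈ ({v} : Set V), openEdgeCluster ζ s') = W} = Eω := by
    ext ζ; simp [hE, hW]
  -- `s` is not in `{v} ∪ V(W)`
  have hsW : ∀ t ∈ ({s} : Set V), ¬ (t ∈ ({v} : Set V) ∨ ∃ e ∈ W, t ∈ e) := by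
    intro t ht
    rw [Set.mem_singleton_iff] at ht; subst ht
    rintro (h | ⟨e, he, hte⟩)
    · exact hvs (Set.mem_singleton_iff.1 h).symm
    · exact hωG ((reachable_iff_exists_mem_openEdgeCluster ω v t).2 (Or.inr ⟨e, he, hte⟩))
  -- on the class, `C_s(ζ) = C_s(ζ ∖ W̄)`
  have hCs : ∀ ζ, ζ ∈ Eω → openEdgeCluster ζ s = openEdgeCluster (ζ \ barOf {v} W) s := by
    intro ζ hζ
    have hζ' : setCl ζ {v} = W := by simp [setCl]; exact hζ
    have := setCl_eq_sdiff_barOf (T := {s}) hζ' hsW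
    simpa [setCl] using this
  have hAeq : ∀ ζ, ζ ∈ Eω → (ζ ∈ A ↔ ζ \ barOf {v} W ∈ A) := by
    intro ζ hζ; simp only [hA, Set.mem_setOf_eq, hCs ζ hζ]
  have hYeq : ∀ ζ, ζ ∈ Eω → (ζ ∈ Y ↔ ζ \ barOf {v} W ∈ Y) := by
    intro ζ hζ
    simp only [hY, openConn_eq_setOf_connFamily, Set.mem_setOf_eq, hCs ζ hζ]
  -- world probabilities via Lemma 2.3
  have hker : ∀ (S : Set (BondConfig V)), (∀ ζ, ζ ∈ Eω → (ζ ∈ S ↔ ζ \ barOf {v} W ∈ S)) →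
      (rcMeasureW (delW u (barOf {v} W)) q ∅).real S = (rcMeasureW u q ∅).real (S ∩ Eω) / (rcMeasureW u q ∅).real Eω := by
    intro S hS
    have h23 := BHK2006_rcMeasureW_real_setCl_inter u hq ({v} : Set V) W S
    rw [hEv] at h23
    have hset : Eω ∩ {ζ | ζ \ barOf {v} W ∈ S} = S ∩ Eω := by
      ext ζ; constructor
      · rintro ⟨h1, h2⟩; exact ⟨(hS ζ h1).2 h2, h1⟩
      · rintro ⟨h1, h2⟩; exact ⟨h2, (hS ζ h2).1 h1⟩
    rw [hset] at h23
    rw [h23]; field_simp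
  have hAY : ∀ ζ, ζ ∈ Eω → (ζ ∈ A ∩ Y ↔ ζ \ barOf {v} W ∈ A ∩ Y) := fun ζ hζ => by
    rw [Set.mem_inter_iff, Set.mem_inter_iff, hAeq ζ hζ, hYeq ζ hζ]
  -- the three world expectations
  unfold taC
  rw [hcut]
  have w1 : wE u q (barOf {v} W) (fun η => U.indicator 1 (openEdgeCluster η s) * ind (openConn s y) η) =
      (rcMeasureW (delW u (barOf {v} W)) q ∅).real (A ∩ Y) := by
    unfold wE; rw [rcMeasureW_real_eq_sum_rcMass _ hq]
    refine Finset.sum_congr rfl fun η _ => ?_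
    simp only [hgA, ind_inter, ← hY]
  have w2 : wE u q (barOf {v} W) (fun η => U.indicator 1 (openEdgeCluster η s)) =
      (rcMeasureW (delW u (barOf {v} W)) q ∅).real A := by
    unfold wE; rw [rcMeasureW_real_eq_sum_rcMass _ hq]
    refine Finset.sum_congr rfl fun η _ => ?_; simp only [hgA]
  have w3 : wE u q (barOf {v} W) (ind (openConn s y)) = (rcMeasureW (delW u (barOf {v} W)) q ∅).real Y := by
    unfold wE; rw [rcMeasureW_real_eq_sum_rcMass _ hq]
  rw [w1, w2, w3, hker (A ∩ Y) hAY, hker A hAeq, hker Y hYeq]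

/-! ### Conditional positive association of `C_s` given `{s ↮ y}` against `{y ↔ v}` -/

/-- **CPA step of Lemma `P_v` (vdBHK Thm 1.3 for `φ_{𝐩,q}` + Lemma 2.4).**  For `q ≥ 1`, an increasing family `U` and vertices
`s, y, v`: `φ(C_s ∈ U, y ↔ v, s ↮ y) · φ(s ↮ y) ≤ φ(y ↔ v, s ↮ y) · φ(C_s ∈ U, s ↮ y)` — given `{s ↮ y}` the increasing
cluster event `{C_s ∈ U}` and the event `{y ↔ v}` (whose world probability `φ_{G − C̄_s}(y ↔ v)` is decreasing in `C_s`) are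
negatively correlated. [cite: VandenbergHaggstromKahn2005, Thm. 1.3 (p. 6), §2.1 Lemma 2.4 (p. 10)] [cite: Grimmett2006, Thm. (3.8)(b)] -/
theorem real_clusterEvent_openConn_notConn_mul_le (u : Sym2 V → unitInterval) {q : ℝ} (hq : 1 ≤ q) (s y v : V)
    (U : Set (Set (Sym2 V))) (hU : IsUpperSet U) :
    (rcMeasureW u q ∅).real ({ω : BondConfig V | openEdgeCluster ω s ∈ U} ∩
          (openConn y v ∩ (openConn s y : Set (BondConfig V))ᶜ)) *
        (rcMeasureW u q ∅).real (openConn s y : Set (BondConfig V))ᶜ ≤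
      (rcMeasureW u q ∅).real (openConn y v ∩ (openConn s y : Set (BondConfig V))ᶜ) *
        (rcMeasureW u q ∅).real ({ω : BondConfig V | openEdgeCluster ω s ∈ U} ∩ (openConn s y : Set (BondConfig V))ᶜ) := by
  classical
  have hq0 : 0 < q := one_pos.trans_le hq
  set A : Set (BondConfig V) := {ω : BondConfig V | openEdgeCluster ω s ∈ U} with hA
  set N : Set (BondConfig V) := (openConn s y : Set (BondConfig V))ᶜ with hN
  set Vv : Set (BondConfig V) := openConn y v with hVv
  have hgA : ∀ η : BondConfig V, U.indicator (1 : Set (Sym2 V) → ℝ) (openEdgeCluster η s) = ind A η :=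
    indicator_one_openEdgeCluster U s
  -- the world probability of `{y ↔ v}` as a function of `C_s`
  set gv : Set (Sym2 V) → ℝ := fun C => ∑ η, rcMass (delW u (barOf {s} C)) q η *
    (connFamily y v).indicator (1 : Set (Sym2 V) → ℝ) (setCl η {y}) with hgv
  have hgv_anti : Antitone gv := by
    intro C C' hCC'
    simp only [hgv]
    refine sum_rcMass_mono_weights (fun e => delW_anti u (barOf_mono ({s} : Set V) hCC') e) hq ?_
    intro η η' hle
    exact monotone_indicator_one_of_isUpperSet (isUpperSet_connFamily y v) (setCl_mono hle {y})
  -- `φ(S ∩ Vv ∩ N) = ∫_N 1_S(C_s) gv(C_s)` for `S` a `C_s`-event, via Lemma 2.4 summed (`rc_set_sum_cond_cluster`)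
  have hker2 : ∀ (𝒮 : Set (Set (Sym2 V))),
      (rcMeasureW u q ∅).real ({ω | openEdgeCluster ω s ∈ 𝒮} ∩ (Vv ∩ N)) =
        ∑ ω, rcMass u q ω * (𝒮.indicator (1 : Set (Sym2 V) → ℝ) (openEdgeCluster ω s) * gv (openEdgeCluster ω s) * ind N ω) := by
    intro 𝒮
    have hD : ∀ ω : BondConfig V, ω ∈ N ↔ ∀ s' ∈ ({s} : Set V), ∀ t ∈ ({y} : Set V), ¬ (openGraph ω).Reachable s' t := by
      intro ω; simp [hN, openConn]
    have h := rc_set_sum_cond_cluster u hq0 ({s} : Set V) ({y} : Set V)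
      (fun C C' => 𝒮.indicator (1 : Set (Sym2 V) → ℝ) C * (connFamily y v).indicator (1 : Set (Sym2 V) → ℝ) C') hD
    have hCs : ∀ ω : BondConfig V, setCl ω {s} = openEdgeCluster ω s := fun ω => by simp [setCl]
    have hCy : ∀ ω : BondConfig V, setCl ω {y} = openEdgeCluster ω y := fun ω => by simp [setCl]
    simp only [hCs] at h
    rw [rcMeasureW_real_eq_sum_rcMass u hq0]
    have hS' : ∀ ω : BondConfig V, 𝒮.indicator (1 : Set (Sym2 V) → ℝ) (openEdgeCluster ω s) = ind {ω | openEdgeCluster ω s ∈ 𝒮} ω := by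
      intro ω
      by_cases h : openEdgeCluster ω s ∈ 𝒮
      · rw [Set.indicator_of_mem h, ind_of_mem (show ω ∈ {ω | openEdgeCluster ω s ∈ 𝒮} from h)]; rfl
      · rw [Set.indicator_of_notMem h, ind_of_not_mem (show ω ∉ {ω | openEdgeCluster ω s ∈ 𝒮} from h)]
    have hVv' : ∀ ω : BondConfig V, (connFamily y v).indicator (1 : Set (Sym2 V) → ℝ) (setCl ω {y}) = ind Vv ω := by
      intro ω
      rw [hCy]
      have hiff : ω ∈ Vv ↔ openEdgeCluster ω y ∈ connFamily y v := by
        rw [hVv, openConn_eq_setOf_connFamily]; rfl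
      by_cases h : ω ∈ Vv
      · rw [Set.indicator_of_mem (hiff.1 h), ind_of_mem h]; rfl
      · rw [Set.indicator_of_notMem (fun h' => h (hiff.2 h')), ind_of_not_mem h]
    have lhs : ∀ ω, rcMass u q ω * ind ({ω | openEdgeCluster ω s ∈ 𝒮} ∩ (Vv ∩ N)) ω =
        rcMass u q ω * (𝒮.indicator (1 : Set (Sym2 V) → ℝ) (openEdgeCluster ω s) *
          (connFamily y v).indicator (1 : Set (Sym2 V) → ℝ) (setCl ω {y}) * ind N ω) := by
      intro ω
      rw [hS', hVv', ind_inter, ind_inter]; ring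
    simp only [lhs]
    rw [h]
    refine Finset.sum_congr rfl fun ω _ => ?_
    simp only [hgv, Finset.mul_sum, Finset.sum_mul]
    refine Finset.sum_congr rfl fun η _ => ?_
    ring
  have hAVN := hker2 U
  have hVN : (rcMeasureW u q ∅).real (Vv ∩ N) = ∑ ω, rcMass u q ω * (gv (openEdgeCluster ω s) * ind N ω) := by
    have h := hker2 Set.univ
    have : {ω : BondConfig V | openEdgeCluster ω s ∈ (Set.univ : Set (Set (Sym2 V)))} ∩ (Vv ∩ N) = Vv ∩ N := by
      ext ω; simp
    rw [this] at h
    rw [h]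
    refine Finset.sum_congr rfl fun ω _ => ?_
    rw [Set.indicator_of_mem (Set.mem_univ _), Pi.one_apply, one_mul]
  -- CPA for `φ_{𝐩,q}`: `F := 1_U` increasing, `G := −gv` increasing (as `gv` is antitone)
  have hPA := BHK2006_clusterConditionalPositiveAssociation_rc u hq s ({y} : Set V) (U.indicator 1) (fun C => -gv C)
    (monotone_indicator_one_of_isUpperSet hU) (fun C C' h => neg_le_neg (hgv_anti h))
  have hDN : {ω : BondConfig V | ∀ x ∈ ({y} : Set V), ¬ (openGraph ω).Reachable s x} = N := by
    ext ω; simp [hN, openConn]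
  rw [hDN] at hPA
  rw [setIntegral_rcMeasureW_eq_sum u hq0, setIntegral_rcMeasureW_eq_sum u hq0, setIntegral_rcMeasureW_eq_sum u hq0] at hPA
  have eA : ∑ ω, rcMass u q ω * (U.indicator (1 : Set (Sym2 V) → ℝ) (openEdgeCluster ω s) * ind N ω) = (rcMeasureW u q ∅).real (A ∩ N) := by
    rw [rcMeasureW_real_eq_sum_rcMass u hq0]
    refine Finset.sum_congr rfl fun ω _ => ?_
    rw [hgA, ind_inter]
  have eG : ∑ ω, rcMass u q ω * (-gv (openEdgeCluster ω s) * ind N ω) = -(rcMeasureW u q ∅).real (Vv ∩ N) := by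
    rw [hVN, ← Finset.sum_neg_distrib]
    refine Finset.sum_congr rfl fun ω _ => ?_; ring
  have eAG : ∑ ω, rcMass u q ω * (U.indicator (1 : Set (Sym2 V) → ℝ) (openEdgeCluster ω s) * -gv (openEdgeCluster ω s) * ind N ω) =
      -(rcMeasureW u q ∅).real (A ∩ (Vv ∩ N)) := by
    rw [hAVN, ← Finset.sum_neg_distrib]
    refine Finset.sum_congr rfl fun ω _ => ?_; ring
  rw [eA, eG, eAG] at hPA
  linarith [hPA]

end Summit.CriticalPhenomena.PercolationContinuityZ3.Theorems.FK

end
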